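import Summits.ABC.StewartYu.PadicW80ParLA
import HarnessLib

/-!
# The `(log p)`-normalised parameter record `PadicW80ParL` — part B of the inequalities

Support file (theorems only; no named facts), cell `abc-stewartyu` (p1, stub S5 of memo-03 §4): twin of
`PadicW80ParB.lean` on the `ℓ`-normalised record. `L_θ ≥ 1`, `2^{J₀} ≤ 2L_θ`, **`T ≥ 2¹¹ m² nV_θ L_θ`** (the
endgame room, now with the normalised `nV_θ = V_θ/ℓ`: `T/L_θ ∝ m² V_θ/ℓ`), the unit `𝔘 = U/2ᵐ` with
`𝔘 ≥ 2^{49m} nG (∏nV) nV_θ W⋆`, hence `𝔘 ≥ 2⁹⁸·{W⋆, G, (∏nV)nV_θ, m}` and `∑V + V_θ ≤ 2⁻⁹⁰𝔘` (via `ℓ ≤ W⋆`),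
`𝔅 = e^{𝔘/64}`, `T W⋆ ≤ 𝔘/c_T`. Proofs are the landed ones with `(V, V_θ, G) ↦ (nV, nV_θ, nG)` inside `U`;
design note HOME/p1/S5-logp-ledger.md. [cite: Waldschmidt1980, §3.2–3.5 (pp. 264–274)] [cite: Yu1990, (2.30)–(2.31)]
-/

noncomputable section

open Finset Real
open Literature.NumberTheory.Transcendental Literature.NumberTheory.Transcendental.Waldschmidt1980

namespace Summit.ABC.StewartYu

open PadicW80Par (cTp cSp cLp cLp' Ap mRp)

namespace PadicW80ParL

variable {d : ℕ} (P : PadicW80ParL d)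

/-- `U/(c_L' m 2^{m+1} S₀ V_θ) ≥ 2`. [folklore] -/
theorem two_le_U_div_Lθden : (2 : ℝ) ≤ P.Uℓ / (cLp' * mRp d * 2 ^ (d + 2) * P.S₀ℓ * P.Vθ) := by
  rw [le_div_iff₀ P.den_Lθ_pos]
  have h := P.U_div_ge
  rw [le_div_iff₀ (by positivity)] at h
  have hS := P.S₀_le
  have hm := (two_le_mR P)
  have hG : 1 ≤ P.nGℓ := P.one_le_nG
  have hVθ := P.one_le_nVθ
  have hW := P.one_le_Wstar
  have hV1 : 1 ≤ ∏ j, P.nV j := P.one_le_prodnV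
  have hℓ := P.ℓ_pos
  -- `S₀ V_θ ≤ 2 c_S m nW⋆ · ℓ nV_θ = 2 c_S m W⋆ nV_θ`
  have hSV : (P.S₀ℓ : ℝ) * P.Vθ ≤ 2 * (cSp * mRp d * P.Wstarℓ) * P.nVθ := by
    rw [P.Vθ_eq]
    calc (P.S₀ℓ : ℝ) * (P.ℓ * P.nVθ) ≤ 2 * (cSp * mRp d * P.nWstarℓ) * (P.ℓ * P.nVθ) := by gcongr
      _ = 2 * (cSp * mRp d * (P.ℓ * P.nWstarℓ)) * P.nVθ := by ring
      _ = 2 * (cSp * mRp d * P.Wstarℓ) * P.nVθ := by rw [← P.Wstar_eq]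
  -- `2 · c_L' m 2^{d+2} S₀ Vθ ≤ 2^{29} m² W⋆ nVθ ≤ 2^{49m} nG (∏nV) nVθ W⋆ 2^{d+1}`
  unfold cLp' cSp at *
  have hmm : mRp d * mRp d ≤ 2 ^ (2 * (d + 1)) := by
    have hmle : mRp d ≤ 2 ^ (d + 1) := by
      unfold mRp
      have : ((d : ℝ) + 1) = ((d + 1 : ℕ) : ℝ) := by push_cast; ring
      rw [this]; exact_mod_cast (Nat.lt_two_pow_self).le
    calc mRp d * mRp d ≤ 2 ^ (d + 1) * 2 ^ (d + 1) := mul_le_mul hmle hmle (mR_pos P).le (by positivity)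
      _ = 2 ^ (2 * (d + 1)) := by rw [← pow_add]; ring_nf
  calc 2 * (2 ^ 12 * mRp d * 2 ^ (d + 2) * (P.S₀ℓ : ℝ) * P.Vθ)
      = 2 * (2 ^ 12 * mRp d * 2 ^ (d + 2)) * ((P.S₀ℓ : ℝ) * P.Vθ) := by ring
    _ ≤ 2 * (2 ^ 12 * mRp d * 2 ^ (d + 2)) * (2 * (2 ^ 15 * mRp d * P.Wstarℓ) * P.nVθ) := by gcongr
    _ = 2 ^ 30 * (mRp d * mRp d) * (2 ^ (d + 1) * P.Wstarℓ * P.nVθ) := by ring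
    _ ≤ 2 ^ 30 * 2 ^ (2 * (d + 1)) * (2 ^ (d + 1) * P.Wstarℓ * P.nVθ) := by gcongr
    _ = 2 ^ (30 + 2 * (d + 1)) * 1 * 1 * P.nVθ * P.Wstarℓ * 2 ^ (d + 1) := by rw [pow_add]; ring
    _ ≤ 2 ^ (49 * (d + 1)) * P.nGℓ * (∏ j, P.nV j) * P.nVθ * P.Wstarℓ * 2 ^ (d + 1) := by
        have hG0 : 0 ≤ P.nGℓ := by linarith
        have hpow : (2 : ℝ) ^ (30 + 2 * (d + 1)) ≤ 2 ^ (49 * (d + 1)) :=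
          pow_le_pow_right₀ (by norm_num) (by omega)
        gcongr
    _ = 2 ^ (49 * (d + 1)) * P.nGℓ * ((∏ j, P.nV j) * P.nVθ) * P.Wstarℓ * 2 ^ (d + 1) := by ring
    _ ≤ P.Uℓ := h

/-- `U/(2 c_L' m 2^{m+1} S₀ V_θ) ≤ L_θ`. [folklore] -/
theorem Lθ_ge : P.Uℓ / (cLp' * mRp d * 2 ^ (d + 2) * P.S₀ℓ * P.Vθ) / 2 ≤ P.Lθℓ := by
  unfold Lθℓ
  have h1 := Nat.lt_floor_add_one (P.Uℓ / (cLp' * mRp d * 2 ^ (d + 2) * P.S₀ℓ * P.Vθ))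
  have h2 := P.two_le_U_div_Lθden
  linarith

/-- `1 ≤ L_θ`. [folklore] -/
theorem one_le_Lθ : 1 ≤ P.Lθℓ := by
  have h := P.Lθ_ge
  have h2 := P.two_le_U_div_Lθden
  have : (1 : ℝ) ≤ P.Lθℓ := by linarith
  exact_mod_cast this

/-- `L_θ < 2^{J₀}`. [folklore] -/
theorem Lθ_lt_two_pow : P.Lθℓ < 2 ^ P.J₀ℓ := Nat.lt_pow_succ_log_self one_lt_two _

/-- `2^{J₀} ≤ 2 L_θ`. [folklore] -/
theorem two_pow_le : 2 ^ P.J₀ℓ ≤ 2 * P.Lθℓ := by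
  unfold J₀ℓ
  rw [pow_succ]
  have := Nat.pow_log_le_self 2 (show P.Lθℓ ≠ 0 by have := P.one_le_Lθ; omega)
  omega

/-- `1 ≤ J₀`. [folklore] -/
theorem one_le_J₀ : 1 ≤ P.J₀ℓ := Nat.le_add_left 1 _

/-- **`T ≥ 2¹¹ m² V_θ L_θ`**: the derivatives outnumber the smallest exponent range by the
factor `c_L' c_S m² nV_θ/c_T` — the source of all the room in the numerical conditions
(`T/2^{J₀} ≥ 2¹⁰ m² nV_θ`; here `nV_θ = V_θ/ℓ ≥ 1` because `S₀` carries `1/ℓ`).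
[cite: Waldschmidt1980, (3.10) and (3.14) (p. 265)] [cite: Yu1990, (2.31) (p. 36)] -/
theorem T_ge_Lθ : (2 : ℝ) ^ 11 * mRp d ^ 2 * P.nVθ * P.Lθℓ ≤ P.Tℓ := by
  have hT := P.T_ge
  have hL := P.Lθ_le
  have hS := P.S₀_ge
  have hm := (mR_pos P)
  have hVθ := P.one_le_nVθ
  have hW := P.one_le_Wstar
  have hU := P.U_pos
  have hℓ := P.ℓ_pos
  refine le_trans ?_ hT
  -- `2¹¹ m² nVθ · U/(c_L' m 2^{d+2} S₀ Vθ) ≤ U/(2 c_T 2^{d+1} W⋆)` since `S₀ ≥ c_S m W⋆/ℓ`, `Vθ = ℓ nVθ`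
  unfold cTp cLp' cSp at *
  have hden : 0 < (2 : ℝ) ^ 12 * mRp d * 2 ^ (d + 2) * P.S₀ℓ * P.Vθ := by
    have := P.S₀_pos; have := P.hVθ1; positivity
  have hSℓ : 2 ^ 15 * mRp d * P.Wstarℓ ≤ (P.S₀ℓ : ℝ) * P.ℓ := by
    rw [P.Wstar_eq]
    calc 2 ^ 15 * mRp d * (P.ℓ * P.nWstarℓ) = (2 ^ 15 * mRp d * P.nWstarℓ) * P.ℓ := by ring
      _ ≤ (P.S₀ℓ : ℝ) * P.ℓ := by gcongr
  calc (2 : ℝ) ^ 11 * mRp d ^ 2 * P.nVθ * P.Lθℓ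
      ≤ 2 ^ 11 * mRp d ^ 2 * P.nVθ * (P.Uℓ / (2 ^ 12 * mRp d * 2 ^ (d + 2) * P.S₀ℓ * P.Vθ)) := by gcongr
    _ = P.Uℓ * (mRp d / (2 * 2 ^ (d + 2) * (P.S₀ℓ * P.ℓ))) := by
        rw [P.Vθ_eq]; field_simp
    _ ≤ P.Uℓ * (mRp d / (2 * 2 ^ (d + 2) * (2 ^ 15 * mRp d * P.Wstarℓ))) := by
        apply mul_le_mul_of_nonneg_left _ hU.le
        apply div_le_div_of_nonneg_left hm.le (by positivity)
        gcongr
    _ = P.Uℓ / (2 ^ 16 * 2 ^ (d + 1) * P.Wstarℓ) / 2 := by field_simp; ring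
    _ ≤ P.Uℓ / (2 ^ 14 * 2 ^ (d + 1) * P.Wstarℓ) / 2 := by
        gcongr <;> norm_num


/-! ## Part B (twin of `Waldschmidt1980ParamsB`) -/


/-! ### The unit and the bound -/

/-- `U = 2ᵐ 𝔘`. [folklore] -/
theorem U_eq : P.Uℓ = 2 ^ (d + 1) * P.𝔘ℓ := by
  unfold 𝔘ℓ; field_simp

/-- **`𝔘 ≥ 2^{49m} nG (∏nVⱼ) nV_θ W⋆`.** [folklore] -/
theorem 𝔘_ge : (2 : ℝ) ^ (49 * (d + 1)) * P.nGℓ * ((∏ j, P.nV j) * P.nVθ) * P.Wstarℓ ≤ P.𝔘ℓ := P.U_div_ge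

/-- `1 ≤ ∏ Vⱼ`. [folklore] -/
theorem one_le_prodVs : (1 : ℝ) ≤ ∏ j : Fin d, P.V j := by
  have : ∏ _j : Fin d, (1 : ℝ) ≤ ∏ j, P.V j := prod_le_prod (fun _ _ => zero_le_one) fun j _ => P.hV j
  simpa using this

/-- `1 ≤ (∏ nVⱼ) nV_θ`. [folklore] -/
theorem one_le_prodnVVθ : (1 : ℝ) ≤ (∏ j, P.nV j) * P.nVθ := by
  have := P.one_le_prodnV; have := P.one_le_nVθ; nlinarith

/-- `1 ≤ G`. [folklore] -/
theorem one_le_G : (1 : ℝ) ≤ P.Gℓ := by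
  have := P.eleven_mR_le_G; have := two_le_mR P; nlinarith

/-- **`2⁹⁸ W⋆ ≤ 𝔘`** (`m ≥ 2`). [folklore] -/
theorem Wstar_le_𝔘 : (2 : ℝ) ^ 98 * P.Wstarℓ ≤ P.𝔘ℓ := by
  have h := P.𝔘_ge
  have hG := P.one_le_nG; have hV := P.one_le_prodnVVθ; have hW := P.one_le_Wstar
  have hd : 98 ≤ 49 * (d + 1) := by have := P.hd; omega
  calc (2 : ℝ) ^ 98 * P.Wstarℓ ≤ 2 ^ (49 * (d + 1)) * P.Wstarℓ := by gcongr; norm_num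
    _ = 2 ^ (49 * (d + 1)) * 1 * 1 * P.Wstarℓ := by ring
    _ ≤ 2 ^ (49 * (d + 1)) * P.nGℓ * ((∏ j, P.nV j) * P.nVθ) * P.Wstarℓ := by gcongr
    _ ≤ P.𝔘ℓ := h

/-- `nG · W⋆ = G · nW⋆` (both are `G W⋆/ℓ`). [folklore] -/
theorem nG_mul_Wstar : P.nGℓ * P.Wstarℓ = P.Gℓ * P.nWstarℓ := by
  unfold nGℓ nWstarℓ; ring

/-- `G ≤ nG · W⋆` (the floor `ℓ ≤ W⋆`). [folklore] -/
theorem G_le_nG_mul_Wstar : P.Gℓ ≤ P.nGℓ * P.Wstarℓ := by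
  rw [P.nG_mul_Wstar]
  exact le_mul_of_one_le_right P.G_pos.le P.one_le_nWstar

/-- `2⁹⁸ G ≤ 𝔘` (uses the floor `ℓ ≤ W⋆`). [folklore] -/
theorem G_le_𝔘 : (2 : ℝ) ^ 98 * P.Gℓ ≤ P.𝔘ℓ := by
  have h := P.𝔘_ge
  have hG := P.one_le_G; have hV := P.one_le_prodnVVθ; have hW := P.one_le_Wstar
  have hGW := P.G_le_nG_mul_Wstar; have hnG := P.one_le_nG
  have hd : 98 ≤ 49 * (d + 1) := by have := P.hd; omega
  calc (2 : ℝ) ^ 98 * P.Gℓ ≤ 2 ^ (49 * (d + 1)) * P.Gℓ := by gcongr; norm_num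
    _ ≤ 2 ^ (49 * (d + 1)) * (P.nGℓ * P.Wstarℓ) := by gcongr
    _ = 2 ^ (49 * (d + 1)) * P.nGℓ * 1 * P.Wstarℓ := by ring
    _ ≤ 2 ^ (49 * (d + 1)) * P.nGℓ * ((∏ j, P.nV j) * P.nVθ) * P.Wstarℓ := by
        have : (0 : ℝ) ≤ 2 ^ (49 * (d + 1)) * P.nGℓ := by positivity
        gcongr
    _ ≤ P.𝔘ℓ := h

/-- The normalised sizes are lower-order: `(∏nVⱼ) nV_θ ≤ 2⁻⁹⁸ 𝔘`. [folklore] -/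
theorem prodnV_le_𝔘 : (2 : ℝ) ^ 98 * ((∏ j, P.nV j) * P.nVθ) ≤ P.𝔘ℓ := by
  have h := P.𝔘_ge
  have hG := P.one_le_nG; have hV := P.one_le_prodnVVθ; have hW := P.one_le_Wstar
  have hd : 98 ≤ 49 * (d + 1) := by have := P.hd; omega
  have h0 : 0 ≤ (∏ j, P.nV j) * P.nVθ := by positivity
  calc (2 : ℝ) ^ 98 * ((∏ j, P.nV j) * P.nVθ) ≤ 2 ^ (49 * (d + 1)) * ((∏ j, P.nV j) * P.nVθ) := by
        gcongr; norm_num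
    _ = 2 ^ (49 * (d + 1)) * 1 * ((∏ j, P.nV j) * P.nVθ) * 1 := by ring
    _ ≤ 2 ^ (49 * (d + 1)) * P.nGℓ * ((∏ j, P.nV j) * P.nVθ) * P.Wstarℓ := by gcongr
    _ ≤ P.𝔘ℓ := h

/-- `∑ nVⱼ + nV_θ ≤ (d+1) · (∏nVⱼ) nV_θ` (each normalised size is at most the product of all). [folklore] -/
theorem sumnV_le : (∑ j, P.nV j) + P.nVθ ≤ (mRp d) * ((∏ j, P.nV j) * P.nVθ) := by
  have hVθ := P.one_le_nVθ
  have hP := P.one_le_prodnV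
  have hVj : ∀ j, P.nV j ≤ (∏ i, P.nV i) * P.nVθ := by
    intro j
    have h1 : P.nV j ≤ ∏ i, P.nV i := by
      rw [← Finset.mul_prod_erase _ _ (mem_univ j)]
      have : 1 ≤ ∏ i ∈ (univ : Finset (Fin d)).erase j, P.nV i := by
        have : ∏ _i ∈ (univ : Finset (Fin d)).erase j, (1 : ℝ) ≤ ∏ i ∈ (univ : Finset (Fin d)).erase j, P.nV i :=
          prod_le_prod (fun _ _ => zero_le_one) fun i _ => P.one_le_nV i
        simpa using this
      have h0 : 0 ≤ P.nV j := le_trans zero_le_one (P.one_le_nV j)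
      nlinarith
    have h0 : 0 ≤ ∏ i, P.nV i := le_trans zero_le_one hP
    nlinarith
  have hθ : P.nVθ ≤ (∏ i, P.nV i) * P.nVθ := le_mul_of_one_le_left (by linarith) hP
  calc (∑ j, P.nV j) + P.nVθ ≤ (∑ _j : Fin d, (∏ i, P.nV i) * P.nVθ) + (∏ i, P.nV i) * P.nVθ :=
        add_le_add (sum_le_sum fun j _ => hVj j) hθ
    _ = (mRp d) * ((∏ j, P.nV j) * P.nVθ) := by
        simp only [sum_const, card_univ, Fintype.card_fin, nsmul_eq_mul]; unfold mRp; ring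

/-- `∑ Vⱼ + V_θ = ℓ · (∑ nVⱼ + nV_θ)`. [folklore] -/
theorem sumV_eq : (∑ j, P.V j) + P.Vθ = P.ℓ * ((∑ j, P.nV j) + P.nVθ) := by
  rw [mul_add, mul_sum, ← P.Vθ_eq]
  congr 1
  exact sum_congr rfl fun j _ => P.V_eq j

/-- `m ≤ W⋆/9 ≤ 2⁻⁹⁸ 𝔘`. [folklore] -/
theorem mR_le_𝔘 : (2 : ℝ) ^ 98 * mRp d ≤ P.𝔘ℓ := by
  have h1 := P.nine_mR_le_Wstar; have h2 := P.Wstar_le_𝔘; have := mR_pos P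
  nlinarith

/-- `∑Vⱼ + V_θ ≤ 2⁻⁹⁰ 𝔘` (`∑V + V_θ = ℓ(∑nV + nV_θ) ≤ ℓ m (∏nV)nV_θ`, and `ℓ ≤ W⋆`, `2⁹⁰ m ≤ 2^{49m}`). [folklore] -/
theorem sumV_le_𝔘 : (2 : ℝ) ^ 90 * ((∑ j, P.V j) + P.Vθ) ≤ P.𝔘ℓ := by
  have h1 := P.sumnV_le
  have hm := mR_pos P
  have h0 : 0 ≤ (∏ j, P.nV j) * P.nVθ := le_trans zero_le_one P.one_le_prodnVVθ
  have h := P.𝔘_ge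
  have hG := P.one_le_nG; have hW := P.ℓ_le_Wstar; have hℓ := P.ℓ_pos
  have hpow : (2 : ℝ) ^ 90 * mRp d ≤ 2 ^ (49 * (d + 1)) := by
    have hm2 : mRp d ≤ 2 ^ (d + 1) := by
      unfold mRp
      have : ((d : ℝ) + 1) = ((d + 1 : ℕ) : ℝ) := by push_cast; ring
      rw [this]; exact_mod_cast (Nat.lt_two_pow_self).le
    have hd := P.hd
    calc (2 : ℝ) ^ 90 * mRp d ≤ 2 ^ 90 * 2 ^ (d + 1) := by gcongr
      _ = 2 ^ (91 + d) := by rw [← pow_add]; ring_nf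
      _ ≤ 2 ^ (49 * (d + 1)) := pow_le_pow_right₀ (by norm_num) (by omega)
  rw [P.sumV_eq]
  calc (2 : ℝ) ^ 90 * (P.ℓ * ((∑ j, P.nV j) + P.nVθ)) ≤ 2 ^ 90 * (P.ℓ * ((mRp d) * ((∏ j, P.nV j) * P.nVθ))) := by
        gcongr
    _ = (2 ^ 90 * mRp d) * ((∏ j, P.nV j) * P.nVθ) * P.ℓ := by ring
    _ ≤ 2 ^ (49 * (d + 1)) * ((∏ j, P.nV j) * P.nVθ) * P.ℓ := by gcongr
    _ = 2 ^ (49 * (d + 1)) * 1 * ((∏ j, P.nV j) * P.nVθ) * P.ℓ := by ring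
    _ ≤ 2 ^ (49 * (d + 1)) * P.nGℓ * ((∏ j, P.nV j) * P.nVθ) * P.Wstarℓ := by
        have h49 : (0 : ℝ) ≤ 2 ^ (49 * (d + 1)) := pow_nonneg zero_le_two _
        have hG0 : (0 : ℝ) ≤ P.nGℓ := le_trans zero_le_one hG
        have step : (2 : ℝ) ^ (49 * (d + 1)) * 1 * ((∏ j, P.nV j) * P.nVθ) ≤
            2 ^ (49 * (d + 1)) * P.nGℓ * ((∏ j, P.nV j) * P.nVθ) :=
          mul_le_mul_of_nonneg_right (mul_le_mul_of_nonneg_left hG h49) h0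
        exact mul_le_mul step hW hℓ.le (mul_nonneg (mul_nonneg h49 hG0) h0)
    _ ≤ P.𝔘ℓ := h

/-- `0 < 𝔘`, indeed `2⁹⁸ ≤ 𝔘`. [folklore] -/
theorem 𝔘_ge' : (2 : ℝ) ^ 98 ≤ P.𝔘ℓ := by
  have := P.Wstar_le_𝔘; have := P.one_le_Wstar; nlinarith

/-- `0 < 𝔘`. [folklore] -/
theorem 𝔘_pos : 0 < P.𝔘ℓ := lt_of_lt_of_le (by norm_num) P.𝔘_ge'

/-- `1 ≤ 𝔅`. [folklore] -/
theorem one_le_𝔅 : 1 ≤ P.𝔅ℓ := Real.one_le_exp (div_nonneg P.𝔘_pos.le (by norm_num))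

/-- `0 < 𝔅`. [folklore] -/
theorem 𝔅_pos : 0 < P.𝔅ℓ := Real.exp_pos _

/-- `exp y ≤ 𝔅` when `y ≤ 𝔘/64`. [folklore] -/
theorem exp_le_𝔅 {y : ℝ} (hy : y ≤ P.𝔘ℓ / 64) : Real.exp y ≤ P.𝔅ℓ := Real.exp_le_exp.mpr hy

/-- `y ≤ 𝔅` when `log y ≤ 𝔘/64`. [folklore] -/
theorem le_𝔅_of_log_le {y : ℝ} (hy : Real.log y ≤ P.𝔘ℓ / 64) : y ≤ P.𝔅ℓ := by
  rcases le_or_gt y 0 with h | h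
  · exact h.trans P.𝔅_pos.le
  · rw [← Real.exp_log h]; exact P.exp_le_𝔅 hy

/-! ### `T`, `S₀` against the unit -/

/-- **`T W⋆ ≤ 𝔘/c_T`.** [folklore] -/
theorem TWstar_le : (P.Tℓ : ℝ) * P.Wstarℓ ≤ P.𝔘ℓ / cTp := by
  have h := P.T_le
  have hW := P.one_le_Wstar
  unfold cTp at *
  rw [P.U_eq] at h
  rw [le_div_iff₀ (by positivity)] at h
  rw [le_div_iff₀ (by norm_num)]
  have key : ((P.Tℓ : ℝ) * P.Wstarℓ * 2 ^ 14) * 2 ^ (d + 1) ≤ P.𝔘ℓ * 2 ^ (d + 1) := by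
    calc ((P.Tℓ : ℝ) * P.Wstarℓ * 2 ^ 14) * 2 ^ (d + 1) = P.Tℓ * (2 ^ 14 * 2 ^ (d + 1) * P.Wstarℓ) := by ring
      _ ≤ 2 ^ (d + 1) * P.𝔘ℓ := h
      _ = P.𝔘ℓ * 2 ^ (d + 1) := by ring
  exact le_of_mul_le_mul_right key (by positivity)

/-- `T ≤ 𝔘/c_T`. [folklore] -/
theorem T_le_𝔘 : (P.Tℓ : ℝ) ≤ P.𝔘ℓ / cTp := by
  have h := P.TWstar_le; have hW := P.one_le_Wstar
  have hT : (0 : ℝ) ≤ P.Tℓ := Nat.cast_nonneg _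
  nlinarith

/-- `0 < T` (real). [folklore] -/
theorem T_pos : (0 : ℝ) < P.Tℓ := by have := P.one_le_T; exact_mod_cast this

end PadicW80ParL

end Summit.ABC.StewartYu

end
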